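import Summits.ValiantsHypothesis.ValiantsHypothesis.Theorems.DepthWindowLawCap
import Literature.Computability.AlgebraicComplexity.GenWordAutomaton
import HarnessLib

/-!
# Route `DepthWindow` — the golden-ratio cap at the cell `HomImmHardTwoOne` (lens 4, generation 12)

Companion of `DepthWindowLawCap.lean` (the universal Fibonacci cap `LawCap.fib_cap` / `LawCap.eps_ge` of the
threshold-law template, for every real word).  This file (cone-free, `--supports` the open A-cell `HomImmHardTwoOne`)
puts the cap over the LITERAL hypotheses of the tree's engine and at the cell's parameters:

* `law_engine_eps_ge` — hypotheses: the prefix bound `2^{|w_{[t]}|} ≤ n` under which `P_w` is a restriction of `IMM_{n,d}`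
  (`GenWord.wordSubst`) and the threshold / law / step / fit hypotheses of `Law.relRank_eval_le_law`
  (`DepthWindowGenFlatRank.lean`) verbatim; conclusion: in the regime `d < 4^{F_Δ}` the engine's `ε` is at least
  `2^{-2(⌊log₂ n⌋ + 1)} ≥ (2n)^{-2}` — for every word `(sz, pos)` of every length and alphabet;
* `cell_small` — with `d = ⌊√⌊log₂ m⌋⌋` and `Δ = 2·L₃(m) + c` (`L₃(m) = ⌊log₂⌊log₂⌊log₂ m⌋⌋⌋`; the product-depth budget of
  `HomImmHardAt 2 1 = HomImmHardTwoOne`), `d < 4^{F_Δ}` for every `c` and all `m ≥ 16`;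
* `cell_barrier` — hence at the cell EVERY instance of the template has `ε ≥ 2^{-2(⌊log₂ n⌋+1)}`, and
  `Law.relRank_eval_le_law` can certify there at most `relrk ≤ (s d^d+1)^Δ (2n)^{-2}`, i.e. (against
  `relrk(P_w) ≥ n^{-1/2}`, `GenWord.relRank_wordPoly_ge`) `(s d^d + 1)^Δ ≥ 4 n^{3/2}`: a polynomial bound, never
  `size > m^c` for all `c`.

So on the chasm axis the threshold-law method — the engine behind every closed `Hard(σ)` cell of the dial
(`homImmHardAt_of_le_36_25`, [BhargavDuttaSaxena2024, Thm 1.2]) — is a certified BARRIER at the open cell `σ = 2` (indeed at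
every `σ > 1/log₂ φ`), uniformly in the word.  Unconditional, 0 sorry; barrier currency only — nothing here bears on
`VP ≠ VNP` itself.

References: [BhargavDuttaSaxena2024] Claim 5.4, Thm 1.2; [LimayeSrinivasanTavenas2025] Claim 16, Lemma 15;
[LimayeSrinivasanTavenas2022] Lemma 9.
-/

-- layout Summits/ValiantsHypothesis/ValiantsHypothesis forces the duplicated namespace component
set_option linter.dupNamespace false

namespace Summit.ValiantsHypothesis.ValiantsHypothesis.Theorems.DepthWindow.LawCap

open Finset

/-! ### Over the engine's literal hypotheses (`GenWord.wsum`, `GenWord.overLen`) -/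

section Engine

open Literature.Computability.AlgebraicComplexity Literature.Computability.AlgebraicComplexity.GenWord

/-- **The threshold-law engine is capped, for every word.**  Hypotheses: the prefix bound `2^{|w_{[t]}|} ≤ n` under
which `P_w` is a restriction of `IMM_{n,d}` (`GenWord.wordSubst`), and the threshold/law/step/fit hypotheses of
`Law.relRank_eval_le_law` verbatim (`hθ1`, `hlaw`, `hstep`, `hfit`).  Conclusion: in the regime `d < 4^{F_Δ}` the
engine's `ε` is at least `2^{-2(⌊log₂ n⌋+1)} ≥ (2n)^{-2}`. -/
theorem law_engine_eps_ge {d : ℕ} (sz : Fin d → ℕ) (pos : Fin d → Bool) {n : ℕ}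
    (hn : ∀ t, 2 ^ overLen sz pos t ≤ n) {Δ : ℕ} (hΔ : 1 ≤ Δ) {θ κ : ℕ → ℝ} {ε : ℝ}
    (hθ1 : ∀ p, 1 < θ p)
    (hlaw : ∀ p, p < Δ → ∀ W : Finset (Fin d), (W.card : ℝ) < θ p →
      (W.card : ℝ) * κ p ≤ |(wsum sz pos W : ℝ)|)
    (hstep : ∀ p, p < Δ → (2 : ℝ) ^ (-κ p * θ (p + 1) / 2) ≤ ε)
    (hfit : θ Δ ≤ d) (hsmall : d < 4 ^ Nat.fib Δ) :
    (2 : ℝ) ^ (-(2 * ((Nat.log 2 n : ℝ) + 1))) ≤ ε := by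
  classical
  set f : ℕ → ℝ := fun m => if h : m < d then (wt sz pos ⟨m, h⟩ : ℝ) else 0 with hf
  -- a block set of naturals below `d` is a block set of `Fin d` with the same size and weight
  have bridge : ∀ W : Finset ℕ, W ⊆ range d →
      ((univ.filter fun i : Fin d => (i : ℕ) ∈ W).card : ℝ) = W.card ∧
      ∑ m ∈ W, f m = (wsum sz pos (univ.filter fun i : Fin d => (i : ℕ) ∈ W) : ℝ) := by
    intro W hW
    set W' := univ.filter fun i : Fin d => (i : ℕ) ∈ W with hW'
    have hmap : W'.map Fin.valEmbedding = W := by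
      ext m
      simp only [mem_map, hW', mem_filter, mem_univ, true_and, Fin.valEmbedding_apply]
      constructor
      · rintro ⟨i, hi, rfl⟩; exact hi
      · intro hm
        exact ⟨⟨m, mem_range.1 (hW hm)⟩, hm, rfl⟩
    refine ⟨?_, ?_⟩
    · calc ((W'.card : ℕ) : ℝ) = ((W'.map Fin.valEmbedding).card : ℝ) := by rw [card_map]
        _ = W.card := by rw [hmap]
    · calc ∑ m ∈ W, f m = ∑ m ∈ W'.map Fin.valEmbedding, f m := by rw [hmap]
        _ = ∑ i ∈ W', f (i : ℕ) := sum_map _ _ _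
        _ = ∑ i ∈ W', (wt sz pos i : ℝ) := sum_congr rfl fun i _ => by simp [hf, i.isLt]
        _ = (wsum sz pos W' : ℝ) := by simp only [wsum, Int.cast_sum]
  have hn1 : 1 ≤ n := le_trans Nat.one_le_two_pow (hn 0)
  set M : ℝ := (Nat.log 2 n : ℝ) + 1 with hM
  have hM0 : 0 < M := by positivity
  have hpre : ∀ j, j ≤ d → |∑ m ∈ range j, f m| ≤ M := by
    intro j hj
    obtain ⟨-, hsum⟩ := bridge (range j)
      (fun x hx => mem_range.2 (lt_of_lt_of_le (mem_range.1 hx) hj))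
    have hset : (univ.filter fun i : Fin d => (i : ℕ) ∈ range j) =
        (univ.filter fun i : Fin d => (i : ℕ) < j) := by
      ext i; simp
    rw [hsum, hset]
    have hov := overLen_eq_natAbs sz pos j hj
    have hle : overLen sz pos j ≤ Nat.log 2 n := Nat.le_log_of_pow_le (by norm_num) (hn j)
    have habs : |(wsum sz pos (univ.filter fun i : Fin d => (i : ℕ) < j) : ℝ)| =
        (overLen sz pos j : ℝ) := by
      rw [hov, Nat.cast_natAbs, Int.cast_abs]
    rw [habs, hM]
    have : (overLen sz pos j : ℝ) ≤ Nat.log 2 n := by exact_mod_cast hle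
    linarith
  have hlaw' : ∀ p, p < Δ → ∀ W : Finset ℕ, W ⊆ range d → (W.card : ℝ) < θ p →
      (W.card : ℝ) * κ p ≤ |∑ m ∈ W, f m| := by
    intro p hp W hW hcard
    obtain ⟨hc, hsum⟩ := bridge W hW
    have h := hlaw p hp (univ.filter fun i : Fin d => (i : ℕ) ∈ W) (by rw [hc]; exact hcard)
    rwa [hc, ← hsum] at h
  have h := eps_ge f hM0 hpre hθ1 hlaw' hstep hΔ hfit hsmall
  simpa [hM] using h

/-! ### The cell `HomImmHardTwoOne` lies in the capped regime -/

/-- `2^L ≤ 2 F_{2L}` for `L ≥ 1`. -/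
theorem two_pow_le_two_mul_fib (L : ℕ) (hL : 1 ≤ L) : 2 ^ L ≤ 2 * Nat.fib (2 * L) := by
  induction L, hL using Nat.le_induction with
  | base => decide
  | succ L hL ih =>
    rw [show 2 * (L + 1) = 2 * L + 2 by ring, Nat.fib_add_two, pow_succ]
    have : Nat.fib (2 * L) ≤ Nat.fib (2 * L + 1) := Nat.fib_mono (by omega)
    omega

/-- **The cell regime.**  With `d = ⌊√⌊log₂ m⌋⌋` and `Δ = 2·L₃(m) + c` (`L₃(m) = ⌊log₂⌊log₂⌊log₂ m⌋⌋⌋`, the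
product-depth budget of `HomImmHardAt 2 1` = `HomImmHardTwoOne`), `d < 4^{F_Δ}` for every `c` and every `m ≥ 16`. -/
theorem cell_small (m : ℕ) (hm : 16 ≤ m) (c : ℕ) :
    Nat.sqrt (Nat.log 2 m) < 4 ^ Nat.fib (2 * Nat.log 2 (Nat.log 2 (Nat.log 2 m)) / 1 + c) := by
  set L₁ := Nat.log 2 m with hL₁
  set L₂ := Nat.log 2 L₁ with hL₂
  set L₃ := Nat.log 2 L₂ with hL₃
  have h16 : Nat.log 2 16 = 4 := by
    rw [show (16 : ℕ) = 2 ^ 4 by norm_num, Nat.log_pow (by norm_num)]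
  have h4 : Nat.log 2 4 = 2 := by
    rw [show (4 : ℕ) = 2 ^ 2 by norm_num, Nat.log_pow (by norm_num)]
  have h2 : Nat.log 2 2 = 1 := by
    simpa using Nat.log_pow (b := 2) (by norm_num) 1
  have hL₁4 : 4 ≤ L₁ := by rw [hL₁, ← h16]; exact Nat.log_mono_right hm
  have hL₂2 : 2 ≤ L₂ := by rw [hL₂, ← h4]; exact Nat.log_mono_right hL₁4
  have hL₃1 : 1 ≤ L₃ := by rw [hL₃, ← h2]; exact Nat.log_mono_right hL₂2
  set F := Nat.fib (2 * L₃ / 1 + c) with hF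
  have k1 : Nat.sqrt L₁ * Nat.sqrt L₁ ≤ L₁ := Nat.sqrt_le L₁
  have k2 : L₁ < 2 ^ (L₂ + 1) := Nat.lt_pow_succ_log_self (by norm_num) L₁
  have k3 : L₂ < 2 ^ (L₃ + 1) := Nat.lt_pow_succ_log_self (by norm_num) L₂
  have k4 : 2 ^ (L₂ + 1) ≤ 2 ^ (2 ^ (L₃ + 1)) := Nat.pow_le_pow_right (by norm_num) k3
  have k5 : 2 ^ (L₃ + 1) ≤ 4 * Nat.fib (2 * L₃) := by
    have := two_pow_le_two_mul_fib L₃ hL₃1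
    rw [pow_succ]; omega
  have k6 : Nat.fib (2 * L₃) ≤ F := Nat.fib_mono (by omega)
  have k7 : 2 ^ (2 ^ (L₃ + 1)) ≤ 2 ^ (4 * F) := Nat.pow_le_pow_right (by norm_num) (k5.trans (by omega))
  have k8 : (2 : ℕ) ^ (4 * F) = 4 ^ F * 4 ^ F := by
    rw [show 4 * F = 2 * F + 2 * F by ring, pow_add, pow_mul]
    norm_num
  have k9 : Nat.sqrt L₁ * Nat.sqrt L₁ < 4 ^ F * 4 ^ F := by
    calc Nat.sqrt L₁ * Nat.sqrt L₁ ≤ L₁ := k1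
      _ < 2 ^ (L₂ + 1) := k2
      _ ≤ 2 ^ (2 ^ (L₃ + 1)) := k4
      _ ≤ 2 ^ (4 * F) := k7
      _ = 4 ^ F * 4 ^ F := k8
  exact Nat.mul_self_lt_mul_self_iff.1 k9

/-- **BARRIER at the cell, for every instance of the template.**  At the parameters of `HomImmHardTwoOne`
(`n × n` matrices restricted along a word of length `d = ⌊√⌊log₂ m⌋⌋` with `2^{|w_{[t]}|} ≤ n`, product-depth budget
`Δ = 2·L₃(m) + c`), for all `m ≥ 16`, all `c`, every word, all thresholds `θ_p > 1`, all law constants, every `ε` admitted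
by the step hypothesis and the fit `θ_Δ ≤ d`: `ε ≥ 2^{-2(⌊log₂ n⌋ + 1)}`.  Hence `Law.relRank_eval_le_law` yields there at
most `relrk ≤ (s d^d+1)^Δ (2n)^{-2}`, i.e. (against `relrk(P_w) ≥ n^{-1/2}`) a polynomial size bound only. -/
theorem cell_barrier (m : ℕ) (hm : 16 ≤ m) (c : ℕ)
    (sz : Fin (Nat.sqrt (Nat.log 2 m)) → ℕ) (pos : Fin (Nat.sqrt (Nat.log 2 m)) → Bool) {n : ℕ}
    (hn : ∀ t, 2 ^ overLen sz pos t ≤ n) {θ κ : ℕ → ℝ} {ε : ℝ}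
    (hθ1 : ∀ p, 1 < θ p)
    (hlaw : ∀ p, p < 2 * Nat.log 2 (Nat.log 2 (Nat.log 2 m)) / 1 + c →
      ∀ W : Finset (Fin (Nat.sqrt (Nat.log 2 m))), (W.card : ℝ) < θ p →
        (W.card : ℝ) * κ p ≤ |(wsum sz pos W : ℝ)|)
    (hstep : ∀ p, p < 2 * Nat.log 2 (Nat.log 2 (Nat.log 2 m)) / 1 + c →
      (2 : ℝ) ^ (-κ p * θ (p + 1) / 2) ≤ ε)
    (hfit : θ (2 * Nat.log 2 (Nat.log 2 (Nat.log 2 m)) / 1 + c) ≤ Nat.sqrt (Nat.log 2 m)) :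
    (2 : ℝ) ^ (-(2 * ((Nat.log 2 n : ℝ) + 1))) ≤ ε := by
  have hsmall := cell_small m hm c
  have hΔ : 1 ≤ 2 * Nat.log 2 (Nat.log 2 (Nat.log 2 m)) / 1 + c := by
    -- `θ_Δ ≤ d` with `θ_Δ > 1` gives `d ≥ 2`; if `Δ = 0` then `d < 4^{F_0} = 1`, absurd
    by_contra h0
    have hΔ0 : 2 * Nat.log 2 (Nat.log 2 (Nat.log 2 m)) / 1 + c = 0 := by omega
    rw [hΔ0, Nat.fib_zero, pow_zero] at hsmall
    have h1 : (1 : ℝ) < (Nat.sqrt (Nat.log 2 m) : ℝ) := (hθ1 _).trans_le hfit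
    have h2 : 1 < Nat.sqrt (Nat.log 2 m) := by exact_mod_cast h1
    omega
  exact law_engine_eps_ge sz pos hn hΔ hθ1 hlaw hstep hfit hsmall

end Engine

end Summit.ValiantsHypothesis.ValiantsHypothesis.Theorems.DepthWindow.LawCap
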